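import Summits.ABC.ABC.Theorems.CongruentialReceptacleTameLocalReceptacleKeyCellDefs
import Mathlib.Analysis.Normed.Group.InfiniteSum

/-!
# Crux `CongruentialReceptacle.TameLocalReceptacle` (stmt-ABC-14354), line `grh-friable-cell-resolution`:
# objects of the reshaped hardest stub (cell laws, model, profiles)

Lead `prover-line-stmt-ABC-14354-a1-0`, skeleton v4 (2026-08-17).  The hardest stub
`stub_keyCellStructure : FriableCharSumBound → SmoothLocalBehaviour → KeyCellStructure (1/4)` of the checked skeleton
`Cruxes/TameLocalReceptacle/Lines/grh_friable_cell_resolution.lean` is reshaped at the skeleton level into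

* an ENGINE OUTPUT `CellLawsPackage κ`: five families with the shape clauses of `KeyCellStructure κ`, a size clause,
  friable members, vanishing of inadmissible classes, SHALLOW cell asymptotics against the explicit LOCAL MODEL
  `cellModel` (relative error `e`), and smallness of the non-shallow tails (real and model);
* the bookkeeping `CellLawsPackage (1/4) → TiltBound → KeyCellStructure (1/4)` and the elementary `TiltBound`;
* two profile tools for the engine's smooth ⟷ sharp passage: `ProfileCharSumBound` (the currency
  `FriableCharSumBound` extended to absolutely summable profile weights `Σ_ℓ c_ℓ W_{λ+ℓ}` — PROVED here from
  `FriableCharSumBound`, registered stub `stub_profileCharSum`) and `PlateauProfiles` (existence of plateau bumps in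
  that class, a Fourier-series fact).

THE LOCAL MODEL.  For a family whose three members have model friable densities `q^{−a_A}, q^{−a_B}, q^{−a_C}` at an
odd prime `q` (exponents `a_P ∈ [3/4, 1]`, the saddle points of the members' scales), the singular-series heuristic —
independent members with those valuation laws and uniform unit parts, conditioned on `a + b = c` — predicts, for
`v ≥ 1` and an ADMISSIBLE class `(r, s, z)`,
`P(q^v ∥ member_P, class) = cellModel a_A a_B a_C P q v = q^{−v a_P} / ((q−1)² · D)`,
`D = normD a_A a_B a_C q = (q−2)/(q−1) + Σ_P q^{−a_P}/(1 − q^{−a_P})`, and probability `0` for inadmissible classes.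
Paired rows of `MatchingFamilies` compare members with EQUAL exponent at the compared position (aligned boxes), so their
models differ only through `D`, by `O(q^{−3/4})` relatively — whence `TiltBound` (an absolute constant).

Deliberately NOT here: the families, the engine, any proof about `KeyCellStructure` (they are the stubs).
-/

-- `Summit.<Summit>.<Problem>` is the mandated summit-side namespace (CONVENTIONS §2); for the
-- single-conjunct summit `ABC` the two coincide, so the duplicate `ABC.ABC` is deliberate.
set_option linter.dupNamespace false

noncomputable section

namespace Summit.ABC.ABC.Theorems.TameLocalReceptacle

open Finset
open Literature.NumberTheory.Sieve
open Literature.NumberTheory.Sieve.TwistedWeight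

/-! ## The local model -/

namespace Pos

/-- Pick the component of position `P` from a triple of reals. -/
def pick : Pos → ℝ → ℝ → ℝ → ℝ
  | A, x, _, _ => x
  | B, _, y, _ => y
  | C, _, _, z => z

end Pos

/-- Model friable density of divisibility by the odd prime `q` for a member with exponent `a`: `q^{−a}`. -/
def dens (a : ℝ) (q : ℕ) : ℝ :=
  (q : ℝ) ^ (-a)

/-- The normalising factor of the local model at `q` for member exponents `(a_A, a_B, a_C)`:
`D = (q−2)/(q−1) + Σ_P q^{−a_P}/(1 − q^{−a_P})`.  (Junk outside `q ≥ 3`, `a_P > 0`; positive there.) -/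
def normD (aA aB aC : ℝ) (q : ℕ) : ℝ :=
  ((q : ℝ) - 2) / ((q : ℝ) - 1) + dens aA q / (1 - dens aA q) + dens aB q / (1 - dens aB q) +
    dens aC q / (1 - dens aC q)

/-- THE LOCAL MODEL of a cell: the predicted probability that the member in position `P` is exactly divisible by
`q^v` (`v ≥ 1`) AND the tame datum lies in one given ADMISSIBLE class — `q^{−v a_P} / ((q−1)² · D)`. -/
def cellModel (aA aB aC : ℝ) (P : Pos) (q v : ℕ) : ℝ :=
  (q : ℝ) ^ (-((v : ℝ) * P.pick aA aB aC)) / ((((q : ℝ) - 1) ^ 2) * normD aA aB aC q)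

/-- **TILT BOUND** (elementary; registered stub `stub_tiltBound`): two models with exponents in `[3/4, 1]` that agree at
the compared position differ, in total `keyWeight`-weighted cell mass, by at most an absolute constant:
`Σ_{q odd prime < Q} Σ_{1 ≤ v ≤ V} keyWeight · (q−1)² · |cellModel a − cellModel a'| ≤ C_T` for all `Q, V`
(because `|1/D − 1/D'| ≤ 4|D − D'| ≤ 48 q^{−3/4}` and `Σ_q log² q · q^{−3/2} < ∞`). -/
def TiltBound : Prop :=
  ∃ C_T : ℝ, ∀ (aA aB aC aA' aB' aC' : ℝ) (P : Pos),
    aA ∈ Set.Icc (3 / 4 : ℝ) 1 → aB ∈ Set.Icc (3 / 4 : ℝ) 1 → aC ∈ Set.Icc (3 / 4 : ℝ) 1 →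
    aA' ∈ Set.Icc (3 / 4 : ℝ) 1 → aB' ∈ Set.Icc (3 / 4 : ℝ) 1 → aC' ∈ Set.Icc (3 / 4 : ℝ) 1 →
    P.pick aA aB aC = P.pick aA' aB' aC' →
    ∀ Q V : ℕ, ∑ q ∈ oddPrimesBelow Q, ∑ v ∈ Icc 1 V,
      keyWeight (P.exps v) q * ((((q : ℝ) - 1) ^ 2) * |cellModel aA aB aC P q v - cellModel aA' aB' aC' P q v|) ≤ C_T

/-! ## Clauses of the engine output -/

/-- The shape clauses of `KeyCellStructure κ` / `MatchingFamilies κ` for five families at 2-adic depth `N`. -/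
def ShapeClauses (κ : ℝ) (N V₀ : ℕ) (FA FB FC G G' : Finset (ℕ × ℕ × ℕ)) : Prop :=
  FA.Nonempty ∧ FB.Nonempty ∧ FC.Nonempty ∧ G.Nonempty ∧ G'.Nonempty ∧
  (∀ T ∈ FA, IsBalanced κ T.1 T.2.1 T.2.2 ∧ T.1.factorization 2 = N) ∧
  (∀ T ∈ FB, IsBalanced κ T.1 T.2.1 T.2.2 ∧ T.2.1.factorization 2 = N) ∧
  (∀ T ∈ FC, IsBalanced κ T.1 T.2.1 T.2.2 ∧ T.2.2.factorization 2 = N) ∧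
  (∀ T ∈ G, IsBalanced κ T.1 T.2.1 T.2.2 ∧ (T.1 * T.2.1 * T.2.2).factorization 2 ≤ V₀) ∧
  (∀ T ∈ G', IsBalanced κ T.1 T.2.1 T.2.2 ∧ (T.1 * T.2.1 * T.2.2).factorization 2 ≤ V₀)

/-- SIZE clause: the largest member `c` of every triple of `F` is at most `exp(L·N)` (so window-weighted key sums
of a member are `≤ 2 log c ≤ 2LN`). -/
def SizeClause (L : ℝ) (N : ℕ) (F : Finset (ℕ × ℕ × ℕ)) : Prop :=
  ∀ T ∈ F, (T.2.2 : ℝ) ≤ Real.exp (L * N)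

/-- FRIABILITY clause: every prime factor of `abc` is `≤ yb` (so keys live at primes `q ≤ yb`). -/
def FriableMembers (yb : ℕ) (F : Finset (ℕ × ℕ × ℕ)) : Prop :=
  ∀ T ∈ F, ∀ q ∈ (T.1 * T.2.1 * T.2.2).primeFactors, q ≤ yb

/-- INADMISSIBLE classes carry no key (a consequence of coprimality for families of abc-triples). -/
def InadmissibleVanish (F : Finset (ℕ × ℕ × ℕ)) : Prop :=
  ∀ (P : Pos) (q v r s z : ℕ), q.Prime → q ≠ 2 → 1 ≤ v → P.adm q r s z = false →
    intensity F P q (mkDatum (P.exps v) r s z) = 0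

/-- SHALLOW LAW with relative error `e`: for odd primes `q ≤ yb`, `v ≥ 1` with `q^{v+1} ≤ Y`, and admissible
classes, the key intensity is the local model up to the factor `1 ± e`. -/
def ShallowLaw (e : ℝ) (yb Y : ℕ) (aA aB aC : ℝ) (F : Finset (ℕ × ℕ × ℕ)) : Prop :=
  ∀ (P : Pos) (q v r s z : ℕ), q.Prime → q ≠ 2 → q ≤ yb → 1 ≤ v → q ^ (v + 1) ≤ Y → P.adm q r s z = true →
    |intensity F P q (mkDatum (P.exps v) r s z) - cellModel aA aB aC P q v| ≤ e * cellModel aA aB aC P q v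

/-- TAIL clause: the window-weighted mass of the non-shallow cells (`q^{v+1} > Y`) is at most `e`. -/
def TailSmall (e : ℝ) (Y : ℕ) (F : Finset (ℕ × ℕ × ℕ)) : Prop :=
  ∀ (P : Pos) (Q V : ℕ), ∑ q ∈ oddPrimesBelow Q, ∑ v ∈ Icc 1 V,
    (if q ^ (v + 1) ≤ Y then 0 else keyWeight (P.exps v) q * cellMass F P q v) ≤ e

/-- MODEL TAIL clause: the same for the model masses `(q−1)² · cellModel`, over primes `q ≤ yb`. -/
def ModelTailSmall (e : ℝ) (yb Y : ℕ) (aA aB aC : ℝ) : Prop :=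
  ∀ (P : Pos) (Q V : ℕ), ∑ q ∈ oddPrimesBelow Q, ∑ v ∈ Icc 1 V,
    (if q ^ (v + 1) ≤ Y ∨ yb < q then 0 else
      keyWeight (P.exps v) q * ((((q : ℝ) - 1) ^ 2) * cellModel aA aB aC P q v)) ≤ e

/-- **ENGINE OUTPUT — the cell-laws package at balance `κ`.**  There are `V₀` and a size constant `L > 0` such that for
every `e > 0` and every `N₁` there are `N ≥ N₁`, five finite families with the shape clauses of `KeyCellStructure κ`,
exponents `α, α' ∈ [3/4, 1]` (models of the saddle points at the two scales `X`, `X/2^N`), a friability bound `yb` and a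
shallowness threshold `Y`, such that: sizes `c ≤ e^{LN}`; all prime factors `≤ yb`; inadmissible classes vanish; the
SHALLOW LAWS hold with relative error `e` against the models with exponent assignments
`FA ↦ (α', α, α)`, `FB ↦ (α, α', α)`, `FC ↦ (α, α, α')`, `G ↦ (α, α, α)`, `G' ↦ (α', α', α')` (position of the special
member `2^N·m`, resp. all of `G'`, at the small scale); and all real and model tails are `≤ e`.
Intended proof: the GRH circle method for the five aligned friable box families of the line (skeleton docstring). -/
def CellLawsPackage (κ : ℝ) : Prop :=
  ∃ (V₀ : ℕ) (L : ℝ), 0 < L ∧ ∀ e : ℝ, 0 < e → ∀ N₁ : ℕ, ∃ N : ℕ, N₁ ≤ N ∧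
    ∃ FA FB FC G G' : Finset (ℕ × ℕ × ℕ), ∃ (α α' : ℝ) (yb Y : ℕ),
      α ∈ Set.Icc (3 / 4 : ℝ) 1 ∧ α' ∈ Set.Icc (3 / 4 : ℝ) 1 ∧
      ShapeClauses κ N V₀ FA FB FC G G' ∧
      (SizeClause L N FA ∧ SizeClause L N FB ∧ SizeClause L N FC ∧ SizeClause L N G ∧ SizeClause L N G') ∧
      (FriableMembers yb FA ∧ FriableMembers yb FB ∧ FriableMembers yb FC ∧ FriableMembers yb G ∧
        FriableMembers yb G') ∧
      (InadmissibleVanish FA ∧ InadmissibleVanish FB ∧ InadmissibleVanish FC ∧ InadmissibleVanish G ∧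
        InadmissibleVanish G') ∧
      (ShallowLaw e yb Y α' α α FA ∧ ShallowLaw e yb Y α α' α FB ∧ ShallowLaw e yb Y α α α' FC ∧
        ShallowLaw e yb Y α α α G ∧ ShallowLaw e yb Y α' α' α' G') ∧
      (TailSmall e Y FA ∧ TailSmall e Y FB ∧ TailSmall e Y FC ∧ TailSmall e Y G ∧ TailSmall e Y G') ∧
      (ModelTailSmall e yb Y α' α α ∧ ModelTailSmall e yb Y α α' α ∧ ModelTailSmall e yb Y α α α' ∧
        ModelTailSmall e yb Y α α α ∧ ModelTailSmall e yb Y α' α' α')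

/-! ## Profile tools -/

/-- **Profile-weighted character sums** (the currency extended to absolutely summable profile weights): for every
`ε > 0` there is `C > 0` with
`‖Σ_{n ∈ S(X,y)} χ(n) Σ_ℓ c_ℓ W_{λ+ℓ}(n/X)‖ ≤ C · B · (1+|λ|)³ X^{1/2+ε} q^ε` whenever `Σ_ℓ ‖c_ℓ‖ (1+|ℓ|)³ ≤ B`
(summable), for all `q ≠ 0`, non-principal `χ` mod `q`, all `y`, `X ≥ 1`, real `λ`.  Since
`W_{λ+ℓ}(v) = v²(1−v)² e(λv) e(ℓv)`, these weights are `v²(1−v)² e(λv) g(v)` for `g(v) = Σ_ℓ c_ℓ e(ℓv)` — every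
smooth profile supported inside `(0,1)` (see `PlateauProfiles`). -/
def ProfileCharSumBound : Prop :=
  ∀ ε : ℝ, 0 < ε → ∃ C : ℝ, 0 < C ∧ ∀ (q : ℕ) (χ : DirichletCharacter ℂ q), q ≠ 0 → χ ≠ 1 →
    ∀ (y : ℕ) (X lam : ℝ), 1 ≤ X → ∀ (c : ℤ → ℂ) (B : ℝ),
      Summable (fun ℓ : ℤ => ‖c ℓ‖ * (1 + |(ℓ : ℝ)|) ^ 3) →
      ∑' ℓ : ℤ, ‖c ℓ‖ * (1 + |(ℓ : ℝ)|) ^ 3 ≤ B →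
      ‖∑ n ∈ Nat.smoothNumbersUpTo ⌊X⌋₊ (y + 1),
          χ (n : ZMod q) * ∑' ℓ : ℤ, c ℓ * twistWeight (lam + ℓ) (n / X)‖ ≤
        C * B * (1 + |lam|) ^ 3 * X ^ (1 / 2 + ε) * (q : ℝ) ^ ε

/-- **Plateau profiles in the `W`-class** (a Fourier-series fact): for `0 < a − η₀`, `a ≤ b`, `b + η₀ < 1`, `η₀ > 0`
there is a real profile `p` with `0 ≤ p ≤ 1`, `p = 1` on `[a, b]`, `p = 0` off `(a − η₀, b + η₀)`, represented on
`(0, 1]` as `p(v) = Σ_ℓ c_ℓ W_ℓ(v)` with `Σ_ℓ ‖c_ℓ‖(1+|ℓ|)³ < ∞` (take `p = v²(1−v)² g`, `g` a smooth bump divided by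
`v²(1−v)²`, `c_ℓ` the Fourier coefficients of the 1-periodisation of `g`, which decay like `|ℓ|^{−5}`). -/
def PlateauProfiles : Prop :=
  ∀ (a b η₀ : ℝ), 0 < η₀ → 0 < a - η₀ → a ≤ b → b + η₀ < 1 →
    ∃ (p : ℝ → ℝ) (c : ℤ → ℂ),
      Summable (fun ℓ : ℤ => ‖c ℓ‖ * (1 + |(ℓ : ℝ)|) ^ 3) ∧
      (∀ v : ℝ, v ∈ Set.Ioc (0 : ℝ) 1 → HasSum (fun ℓ : ℤ => c ℓ * twistWeight (ℓ : ℝ) v) (p v : ℂ)) ∧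
      (∀ v : ℝ, 0 ≤ p v ∧ p v ≤ 1) ∧
      (∀ v ∈ Set.Icc a b, p v = 1) ∧
      (∀ v : ℝ, v ∉ Set.Ioo (a - η₀) (b + η₀) → p v = 0)

/-! ## `FriableCharSumBound → ProfileCharSumBound` (registered stub `stub_profileCharSum`) -/

/-- **Registered stub `stub_profileCharSum`**: the currency for the modulated weights `W_λ` extends to absolutely
summable profile combinations `Σ_ℓ c_ℓ W_{λ+ℓ}`, with the constant multiplied by `Σ_ℓ ‖c_ℓ‖(1+|ℓ|)³`
(interchange the finite `n`-sum with the `ℓ`-series, bound termwise by `FriableCharSumBound`, and use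
`(1+|λ+ℓ|)³ ≤ (1+|λ|)³(1+|ℓ|)³`). [folklore] -/
theorem stub_profileCharSum : FriableCharSumBound → ProfileCharSumBound := by
  intro hF ε hε
  obtain ⟨C, hC, hB⟩ := hF ε hε
  refine ⟨C, hC, fun q χ hq hχ y X lam hX c B hcs hcB => ?_⟩
  set S : Finset ℕ := Nat.smoothNumbersUpTo ⌊X⌋₊ (y + 1) with hS
  -- the constant of the termwise bound
  set K : ℝ := C * (1 + |lam|) ^ 3 * X ^ (1 / 2 + ε) * (q : ℝ) ^ ε with hK
  have hX0 : 0 < X := lt_of_lt_of_le one_pos hX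
  have hK0 : 0 ≤ K := by
    rw [hK]
    have : 0 ≤ (q : ℝ) ^ ε := Real.rpow_nonneg (Nat.cast_nonneg q) ε
    have : 0 ≤ X ^ (1 / 2 + ε) := Real.rpow_nonneg hX0.le _
    positivity
  -- `1 + |λ + ℓ| ≤ (1 + |λ|)(1 + |ℓ|)` (also `HuxleyZeroDetection.one_add_abs_add_le`, not imported here)
  have hadd : ∀ l : ℝ, 1 + |lam + l| ≤ (1 + |lam|) * (1 + |l|) := by
    intro l
    have h := abs_add_le lam l
    nlinarith [abs_nonneg lam, abs_nonneg l, mul_nonneg (abs_nonneg lam) (abs_nonneg l)]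
  -- termwise: `‖Σ_n χ(n) W_{λ+ℓ}(n/X)‖ ≤ K (1+|ℓ|)³`
  have hterm : ∀ l : ℤ, ‖∑ n ∈ S, χ (n : ZMod q) * twistWeight (lam + l) (n / X)‖ ≤
      K * (1 + |(l : ℝ)|) ^ 3 := by
    intro l
    have h := hB q χ hq hχ y X (lam + l) hX
    calc ‖∑ n ∈ S, χ (n : ZMod q) * twistWeight (lam + l) (n / X)‖
        ≤ C * (1 + |lam + l|) ^ 3 * X ^ (1 / 2 + ε) * (q : ℝ) ^ ε := h
      _ ≤ C * ((1 + |lam|) * (1 + |(l : ℝ)|)) ^ 3 * X ^ (1 / 2 + ε) * (q : ℝ) ^ ε := by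
          have h1 : (1 + |lam + l|) ^ 3 ≤ ((1 + |lam|) * (1 + |(l : ℝ)|)) ^ 3 :=
            pow_le_pow_left₀ (by positivity) (hadd l) 3
          have h2 : 0 ≤ X ^ (1 / 2 + ε) := Real.rpow_nonneg hX0.le _
          have h3 : 0 ≤ (q : ℝ) ^ ε := Real.rpow_nonneg (Nat.cast_nonneg q) ε
          have := mul_le_mul_of_nonneg_left h1 hC.le
          have := mul_le_mul_of_nonneg_right (mul_le_mul_of_nonneg_right this h2) h3
          linarith
      _ = K * (1 + |(l : ℝ)|) ^ 3 := by rw [hK]; ring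
  -- summability of every `ℓ ↦ c ℓ * W_{λ+ℓ}(v)` (dominated by `‖c ℓ‖ (1+|ℓ|)³`)
  have hnc : ∀ l : ℤ, ‖c l‖ ≤ ‖c l‖ * (1 + |(l : ℝ)|) ^ 3 := by
    intro l
    have h1 : (1 : ℝ) ≤ (1 + |(l : ℝ)|) ^ 3 := one_le_pow₀ (by linarith [abs_nonneg (l : ℝ)])
    nlinarith [norm_nonneg (c l)]
  have hsW : ∀ v : ℝ, Summable (fun l : ℤ => c l * twistWeight (lam + l) v) := by
    intro v
    refine Summable.of_norm_bounded hcs (fun l => ?_)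
    rw [norm_mul]
    calc ‖c l‖ * ‖twistWeight (lam + l) v‖ ≤ ‖c l‖ * 1 :=
          mul_le_mul_of_nonneg_left (norm_twistWeight_le _ _) (norm_nonneg _)
      _ ≤ ‖c l‖ * (1 + |(l : ℝ)|) ^ 3 := by rw [mul_one]; exact hnc l
  -- interchange the finite sum and the series
  have hswap : ∑ n ∈ S, χ (n : ZMod q) * ∑' l : ℤ, c l * twistWeight (lam + l) (n / X) =
      ∑' l : ℤ, ∑ n ∈ S, χ (n : ZMod q) * (c l * twistWeight (lam + l) (n / X)) := by
    have h1 : ∀ n ∈ S, (χ (n : ZMod q) * ∑' l : ℤ, c l * twistWeight (lam + l) (n / X)) =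
        ∑' l : ℤ, χ (n : ZMod q) * (c l * twistWeight (lam + l) (n / X)) := by
      intro n _
      rw [tsum_mul_left]
    rw [Finset.sum_congr rfl h1]
    rw [Summable.tsum_finsetSum]
    intro n _
    exact (hsW (n / X)).mul_left _
  -- the inner finite sums, as a function of `ℓ`
  set T : ℤ → ℂ := fun l => ∑ n ∈ S, χ (n : ZMod q) * (c l * twistWeight (lam + l) (n / X)) with hT
  have hTeq : ∀ l : ℤ, T l = c l * ∑ n ∈ S, χ (n : ZMod q) * twistWeight (lam + l) (n / X) := by
    intro l
    simp only [hT, Finset.mul_sum]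
    refine Finset.sum_congr rfl fun n _ => ?_
    ring
  have hTnorm : ∀ l : ℤ, ‖T l‖ ≤ K * (‖c l‖ * (1 + |(l : ℝ)|) ^ 3) := by
    intro l
    rw [hTeq l, norm_mul]
    calc ‖c l‖ * ‖∑ n ∈ S, χ (n : ZMod q) * twistWeight (lam + l) (n / X)‖
        ≤ ‖c l‖ * (K * (1 + |(l : ℝ)|) ^ 3) := mul_le_mul_of_nonneg_left (hterm l) (norm_nonneg _)
      _ = K * (‖c l‖ * (1 + |(l : ℝ)|) ^ 3) := by ring
  have hTsum : Summable (fun l : ℤ => ‖T l‖) :=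
    Summable.of_nonneg_of_le (fun l => norm_nonneg _) hTnorm (hcs.mul_left K)
  rw [hswap]
  calc ‖∑' l : ℤ, T l‖ ≤ ∑' l : ℤ, ‖T l‖ := norm_tsum_le_tsum_norm hTsum
    _ ≤ ∑' l : ℤ, K * (‖c l‖ * (1 + |(l : ℝ)|) ^ 3) :=
        Summable.tsum_le_tsum hTnorm hTsum (hcs.mul_left K)
    _ = K * ∑' l : ℤ, ‖c l‖ * (1 + |(l : ℝ)|) ^ 3 := tsum_mul_left
    _ ≤ K * B := mul_le_mul_of_nonneg_left hcB hK0
    _ = C * B * (1 + |lam|) ^ 3 * X ^ (1 / 2 + ε) * (q : ℝ) ^ ε := by rw [hK]; ring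

/-! ## Sanity checks -/

example : Pos.pick Pos.B 1 2 3 = 2 := rfl
example : Pos.pick Pos.C 1 2 3 = 3 := rfl

end Summit.ABC.ABC.Theorems.TameLocalReceptacle

end
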